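import Summits.CriticalPhenomena.PercolationContinuityZ3.Cruxes.PinholeClosing.Disproof

/-!
# Crux-plan `front-blocking-suffices` (crux stmt-CriticalPhenomena-5249 = `PercBudgetLadder.PinholeClosing`):
# NO-SKELETON — kernel-checked costume certificate, and the salvage

Planner seat `planner-cruxplan-stmt-CriticalPhenomena-5249-front-blocking-suffi-0`, 2026-08-16.
`sorry`-free; imports the standing disprover's `Disproof.lean` (§0 dictionary `μc`, `blockedEv`,
`blockProb`; §2 `UniformBudgetBlocking`, `critAnnulusBlockedIO_of_uniform`; §3
`pinholeClosing_of_uniform_blocking`).  Nothing here asserts a route item.  Published as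
`Cruxes/PinholeClosing/FrontBlockingSufficesNoGo.lean` (module `…Cruxes.PinholeClosing.FrontBlockingSufficesNoGo`);
the prose line card is `Cruxes/PinholeClosing/Lines/front-blocking-suffices.md`.  NO skeleton
`Lines/front-blocking-suffices.lean` exists or is registered: this is a dead line.

The idea card (`Ideas/front-blocking-suffices.md`) proposes the stub set
{`TilingCorollary`, `∀ l ≥ 2, HalfSpaceAnnulusBlocking l`} with the proved composition
`TilingCorollary → (∀ l ≥ 2, HalfSpaceAnnulusBlocking l) → PinholeClosing`.  The three triagers
(TRIAGE-r1-1/2/3) failed it as a COSTUME of the uniform critical-annulus RSW bound.  This file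
certifies that verdict mechanically and records what survives:

* §1 the card's objects: `frontCrossed n L` (front-confined crossing of `A(n, L)` w.r.t. the
  closed half-space `{v₀ ≥ 0}`), `HalfSpaceAnnulusBlocking l` (= C⁺(l): uniform-in-`n` front
  blocking at aspect `l`), `TilingBound` (per-`n` form of the routing + Harris bound) and the card's
  `TilingCorollary` (its uniform consequence).
* §2 sandwich, lower side (trivial): `frontCrossed ⊆ crossed`, so `blockProb 0 n L ≤ P(frontCrossedᶜ)`
  and uniform budget-0 blocking at aspect `l` gives C⁺(l); in particular X_B of route
  PercAnnulusCrossing gives C⁺(l) for every `l ≥ 2`.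
* §3 sandwich, upper side + COSTUME: given `TilingCorollary`, the SINGLE instance C⁺(2) already yields
  `UniformBudgetBlocking` (the crux with its premise deleted, Disproof §2) for EVERY budget `k`, hence
  the route TARGET `CritAnnulusBlockedIO` outright (`critAnnulusBlockedIO_of_halfSpace_two`) — with no
  use of `BudgetTightness` (r2) and no use of the crux's premise — and the crux only as the special
  case `pinholeClosing_of_uniform_blocking` of Disproof §3 (`pinholeClosing_of_halfSpace_two`).  So the
  proposed open stub sits ABOVE the whole route, not below the crux: costume by the crux-plan rule
  ("a stub restating the summit / assuming what is to be proved").  `exists_halfSpace_iff_exists_uniform`: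
  modulo the (M-sized, believed) tiling bound, "front blocking at some aspect" IS "uniform RSW at some
  aspect".
* §4 salvage = the premise-carrying cut `FrontClosing k` ("budget-(k+1) blocking at (n, l n) w.p. ≥ c ⇒
  no front-confined crossing of A(n, l n) w.p. ≥ c'"): `TilingBound → (∀ k, FrontClosing k) → PinholeClosing`
  (indeed level `k` from `FrontClosing k` alone, conclusion at budget 0).  It has the crux's own
  resistance profile (`frontClosing_of_not_budgetTightness`, `frontClosing_of_critAnnulusNonCrossing`:
  a refutation would prove r2 and refute X_B), and deleting its premise gives back exactly C⁺
  (`frontClosingWithoutC_iff`) — the costume boundary.  `FrontClosing 0` is halfspace-polarisation's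
  k = 0 lemma and `FrontClosing k ⇐ EccentricShare k` (HP) / `CoherentMass k` (GS), so this cut is a
  RESHAPE suggestion for the halfspace-polarisation line (weakest open stub), not a line under this slug.
-/

namespace Summit.CriticalPhenomena.PercolationContinuityZ3.Cruxes.PinholeClosing.FrontBlockingSuffices

open MeasureTheory Filter
open Literature.Probability.Percolation Literature.Probability.LatticeModels
open Summit.CriticalPhenomena.PercolationContinuityZ3.Theses
open Summit.CriticalPhenomena.PercolationContinuityZ3.Cruxes.PinholeClosing.Disproof

noncomputable section

/-! ## §1 The card's objects -/

/-- The FRONT-CONFINED crossing event of the centred annulus `A(n, L)`: an open path from `box 3 n`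
to `∂ⁱⁿ box 3 L` using only vertices of `box 3 L` in the closed half-space `{v₀ ≥ 0}` (the card's
`frontCrossed 0 1 0 n L`; the other five faces are signed-permutation images). -/
def frontCrossed (n L : ℕ) : Set (BondConfig (Site 3)) :=
  {ω | ∃ x ∈ box 3 n, ∃ y ∈ innerBoundary (zdGraph 3) (box 3 L),
    ω ∈ openConnIn {v : Site 3 | v ∈ box 3 L ∧ 0 ≤ v 0} x y}

/-- C⁺(l) of the card: UNIFORM-in-`n` front-confined blocking at aspect `l`. -/
def HalfSpaceAnnulusBlocking (l : ℕ) : Prop :=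
  ∃ ε : ℝ, 0 < ε ∧ ∀ n : ℕ, 1 ≤ n → ε ≤ μc.real (frontCrossed n (l * n))ᶜ

/-- The tiling bound, per `n` (TilingLemma + Harris over the `6(2l+2)²` face tiles + lattice
symmetries; M-sized, believed, NOT proved here): front blocking at `(n, l n)` with probability `≥ ε`
gives budget-0 blocking at `(n, 2 l n)` with probability `≥ ε^{6(2l+2)²}`, for the same `n`. -/
def TilingBound : Prop :=
  ∀ l : ℕ, 2 ≤ l → ∀ n : ℕ, 1 ≤ n → ∀ ε : ℝ, 0 ≤ ε → ε ≤ μc.real (frontCrossed n (l * n))ᶜ →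
    ε ^ (6 * (2 * l + 2) ^ 2) ≤ blockProb 0 n (2 * l * n)

/-- The card's `TilingCorollary` (uniform hypothesis, uniform conclusion). -/
def TilingCorollary : Prop :=
  ∀ l : ℕ, 2 ≤ l → ∀ ε : ℝ, 0 ≤ ε →
    (∀ n : ℕ, 1 ≤ n → ε ≤ μc.real (frontCrossed n (l * n))ᶜ) →
    ∀ n : ℕ, 1 ≤ n → ε ^ (6 * (2 * l + 2) ^ 2) ≤ blockProb 0 n (2 * l * n)

/-- The per-`n` bound implies the card's corollary. -/
theorem tilingCorollary_of_tilingBound (h : TilingBound) : TilingCorollary :=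
  fun l hl ε hε hall n hn => h l hl n hn ε hε (hall n hn)

/-! ## §2 Sandwich, lower side: uniform blocking ⇒ front blocking (trivial) -/

/-- A front-confined crossing is a crossing: `frontCrossed n L ⊆ (blockedEv 0 n L)ᶜ`. -/
theorem frontCrossed_subset_compl_blockedEv (n L : ℕ) : frontCrossed n L ⊆ (blockedEv 0 n L)ᶜ := by
  rintro ω ⟨x, hx, y, hy, hxS, hyS, hr⟩
  rw [blockedEv_zero, compl_compl]
  have hsub : {v : Site 3 | v ∈ box 3 L ∧ 0 ≤ v 0} ⊆ (↑(box 3 L) : Set (Site 3)) := fun v hv => hv.1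
  exact ⟨x, hx, y, hy, hsub hxS, hsub hyS,
    hr.map (SimpleGraph.induceHomOfLE (G := openGraph ω) hsub).toHom⟩

/-- `P(blocked at budget 0) ≤ P(no front-confined crossing)`. -/
theorem blockProb_le_frontBlocked (n L : ℕ) : blockProb 0 n L ≤ μc.real (frontCrossed n L)ᶜ :=
  measureReal_mono (Set.subset_compl_comm.1 (frontCrossed_subset_compl_blockedEv n L))

/-- UB(l) ⇒ C⁺(l): uniform budget-0 blocking at aspect `l` gives uniform front blocking at aspect `l`. -/
theorem halfSpaceAnnulusBlocking_of_uniformBlocking {l : ℕ}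
    (h : ∃ c : ℝ, 0 < c ∧ ∀ n : ℕ, 1 ≤ n → c ≤ blockProb 0 n (l * n)) :
    HalfSpaceAnnulusBlocking l := by
  obtain ⟨c, hc, hb⟩ := h
  exact ⟨c, hc, fun n hn => (hb n hn).trans (blockProb_le_frontBlocked n (l * n))⟩

/-- X_B ⇒ C⁺(l) for every `l ≥ 2`: the standing uniform RSW crux of route PercAnnulusCrossing
(`CritAnnulusNonCrossing`, aspect 2) implies the card's transfer target at every aspect. -/
theorem halfSpaceAnnulusBlocking_of_critAnnulusNonCrossing
    (hX : PercAnnulusCrossing.CritAnnulusNonCrossing) {l : ℕ} (hl : 2 ≤ l) :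
    HalfSpaceAnnulusBlocking l := by
  obtain ⟨c₀, hc₀, hRSW⟩ := hX
  refine ⟨c₀, hc₀, fun n hn => ?_⟩
  calc c₀ ≤ 1 - μc.real {ω | ∃ x ∈ box 3 n, ∃ y ∈ innerBoundary (zdGraph 3) (box 3 (2 * n)),
            ω ∈ openConnIn ↑(box 3 (2 * n)) x y} := by linarith [hRSW n hn]
    _ ≤ blockProb 0 n (2 * n) := by
        rw [blockProb, blockedEv_zero]; exact one_sub_le_real_compl _
    _ ≤ blockProb 0 n (l * n) := blockProb_mono_aspect (by omega) (Nat.mul_le_mul_right n hl)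
    _ ≤ μc.real (frontCrossed n (l * n))ᶜ := blockProb_le_frontBlocked n (l * n)

/-! ## §3 Sandwich, upper side, and the COSTUME certificate -/

/-- C⁺(l) ⇒ UB(2l), given the tiling corollary. -/
theorem uniformBlocking_of_halfSpace (hT : TilingCorollary) {l : ℕ} (hl : 2 ≤ l)
    (h : HalfSpaceAnnulusBlocking l) :
    ∃ c : ℝ, 0 < c ∧ ∀ n : ℕ, 1 ≤ n → c ≤ blockProb 0 n (2 * l * n) := by
  obtain ⟨ε, hε, hb⟩ := h
  exact ⟨ε ^ (6 * (2 * l + 2) ^ 2), pow_pos hε _, fun n hn => hT l hl ε hε.le hb n hn⟩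

/-- Modulo the tiling corollary, "front blocking at SOME aspect" is "uniform budget-0 blocking at SOME
aspect" — the uniform critical-annulus RSW class. -/
theorem exists_halfSpace_iff_exists_uniform (hT : TilingCorollary) :
    (∃ l : ℕ, 2 ≤ l ∧ HalfSpaceAnnulusBlocking l) ↔
      (∃ l : ℕ, 2 ≤ l ∧ ∃ c : ℝ, 0 < c ∧ ∀ n : ℕ, 1 ≤ n → c ≤ blockProb 0 n (l * n)) := by
  constructor
  · rintro ⟨l, hl, h⟩
    exact ⟨2 * l, by omega, uniformBlocking_of_halfSpace hT hl h⟩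
  · rintro ⟨l, hl, h⟩
    exact ⟨l, hl, halfSpaceAnnulusBlocking_of_uniformBlocking h⟩

/-- Uniform budget-0 blocking at one aspect `l ≥ 2` is the route TARGET (i.o. form, same aspect). -/
theorem critAnnulusBlockedIO_of_uniformBlocking {l : ℕ} (hl : 2 ≤ l)
    (h : ∃ c : ℝ, 0 < c ∧ ∀ n : ℕ, 1 ≤ n → c ≤ blockProb 0 n (l * n)) :
    PercBudgetLadder.CritAnnulusBlockedIO := by
  obtain ⟨c, hc, hb⟩ := h
  refine ⟨l, c, hl, hc, fun N => ⟨N + 1, by omega, ?_⟩⟩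
  have hset : blockedEv 0 (N + 1) (l * (N + 1)) =
      {ω | ¬ ∃ x ∈ box 3 (N + 1), ∃ y ∈ innerBoundary (zdGraph 3) (box 3 (l * (N + 1))),
        ω ∈ openConnIn ↑(box 3 (l * (N + 1))) x y} := by
    ext ω
    simp only [blockedEv, Set.mem_setOf_eq, Nat.le_zero, Finset.card_eq_zero, exists_eq_left,
      Finset.coe_empty, Set.sdiff_empty]
  have h1 := hb (N + 1) (by omega)
  rw [blockProb, hset] at h1
  exact h1

/-- **COSTUME (i).** The single instance C⁺(2), with the tiling corollary, gives `UniformBudgetBlocking`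
— uniform budget-`k` blocking at EVERY aspect `2l ≥ 4` for EVERY `k` — i.e. the crux WITH ITS PREMISE
DELETED (Disproof §2 `pinholeClosingWithoutC_iff`). -/
theorem uniformBudgetBlocking_of_halfSpace_two (hT : TilingCorollary) (h2 : HalfSpaceAnnulusBlocking 2) :
    UniformBudgetBlocking := by
  obtain ⟨c, hc, hb⟩ := uniformBlocking_of_halfSpace hT le_rfl h2
  intro k l hl
  refine ⟨c, hc, fun n hn => ?_⟩
  calc c ≤ blockProb 0 n (2 * 2 * n) := hb n hn
    _ ≤ blockProb 0 n (2 * l * n) :=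
        blockProb_mono_aspect (by omega) (Nat.mul_le_mul_right n (by omega))
    _ ≤ blockProb k n (2 * l * n) := blockProb_mono_budget (Nat.zero_le k) _ _

/-- **COSTUME (ii).** Hence C⁺(2) + tiling prove the route's rank-0 TARGET `CritAnnulusBlockedIO`
outright (aspect 4), using neither `BudgetTightness` (r2) nor the crux's premise. -/
theorem critAnnulusBlockedIO_of_halfSpace_two (hT : TilingCorollary) (h2 : HalfSpaceAnnulusBlocking 2) :
    PercBudgetLadder.CritAnnulusBlockedIO :=
  critAnnulusBlockedIO_of_uniform (uniformBudgetBlocking_of_halfSpace_two hT h2)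

/-- **COSTUME (iii).** … and the crux only as the special case "any uniform blocking bound at aspect ≤ 4
gives r3, premise unused" of Disproof §3 (`pinholeClosing_of_uniform_blocking`). This is the card's
`pinholeClosing_of_halfSpaceBlocking`, factored to show the premise is never consulted. -/
theorem pinholeClosing_of_halfSpace_two (hT : TilingCorollary) (h2 : HalfSpaceAnnulusBlocking 2) :
    PercBudgetLadder.PinholeClosing := by
  obtain ⟨c, hc, hb⟩ := uniformBlocking_of_halfSpace hT le_rfl h2
  refine pinholeClosing_of_uniform_blocking (l₀ := 4) (by norm_num) le_rfl ⟨c, hc, fun n hn => ?_⟩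
  have h := hb n hn
  have h4 : 2 * 2 * n = 4 * n := by ring
  rw [h4] at h
  exact h

/-- The stub set exactly as carded (`∀ l ≥ 2, C⁺(l)`): target. -/
theorem critAnnulusBlockedIO_of_stubs (hT : TilingCorollary)
    (hC : ∀ l : ℕ, 2 ≤ l → HalfSpaceAnnulusBlocking l) : PercBudgetLadder.CritAnnulusBlockedIO :=
  critAnnulusBlockedIO_of_halfSpace_two hT (hC 2 le_rfl)

/-- The stub set exactly as carded: the premise-free uniform statement for every budget. -/
theorem uniformBudgetBlocking_of_stubs (hT : TilingCorollary)
    (hC : ∀ l : ℕ, 2 ≤ l → HalfSpaceAnnulusBlocking l) : UniformBudgetBlocking :=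
  uniformBudgetBlocking_of_halfSpace_two hT (hC 2 le_rfl)

/-- The stub set exactly as carded: the crux (re-derivation of the card's composition). -/
theorem pinholeClosing_of_stubs (hT : TilingCorollary)
    (hC : ∀ l : ℕ, 2 ≤ l → HalfSpaceAnnulusBlocking l) : PercBudgetLadder.PinholeClosing :=
  pinholeClosing_of_halfSpace_two hT (hC 2 le_rfl)

/-- C⁺ at any single aspect `l ≥ 2` already gives the target (aspect `2l`), given the tiling corollary. -/
theorem critAnnulusBlockedIO_of_halfSpace (hT : TilingCorollary) {l : ℕ} (hl : 2 ≤ l)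
    (h : HalfSpaceAnnulusBlocking l) : PercBudgetLadder.CritAnnulusBlockedIO :=
  critAnnulusBlockedIO_of_uniformBlocking (l := 2 * l) (by omega) (uniformBlocking_of_halfSpace hT hl h)

/-! ## §4 Salvage: the premise-carrying cut `FrontClosing k` (belongs to line halfspace-polarisation) -/

/-- `FrontClosing k`: if the annulus `(n, l n)` is budget-`(k+1)` blocked with probability `≥ c`, then
with probability `≥ c'` (uniform in such `n`) it has NO front-confined crossing at all.  `k = 0` is the
polarisation lemma of card halfspace-polarisation (pigeonhole on the single pinhole + root trick +
BackKillsFront); for `k ≥ 1` it is implied by HP's `EccentricShare k` and by GS's `CoherentMass k`. -/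
def FrontClosing (k : ℕ) : Prop :=
  ∀ (l : ℕ) (c : ℝ), 2 ≤ l → 0 < c → ∃ c' : ℝ, 0 < c' ∧ ∀ n : ℕ, 1 ≤ n →
    c ≤ blockProb (k + 1) n (l * n) → c' ≤ μc.real (frontCrossed n (l * n))ᶜ

/-- Level `k` of the crux from `FrontClosing k` alone (conclusion even at budget 0), given the per-`n`
tiling bound: `c' ↦ c'^{6(2l+2)²}`. -/
theorem level_of_frontClosing (hT : TilingBound) {k : ℕ} (hF : FrontClosing k) :
    ∀ (l : ℕ) (c : ℝ), 2 ≤ l → 0 < c → ∃ c' : ℝ, 0 < c' ∧ ∀ n : ℕ, 1 ≤ n →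
      c ≤ blockProb (k + 1) n (l * n) → c' ≤ blockProb k n (2 * l * n) := by
  intro l c hl hc
  obtain ⟨c', hc', hstep⟩ := hF l c hl hc
  refine ⟨c' ^ (6 * (2 * l + 2) ^ 2), pow_pos hc' _, fun n hn hprem => ?_⟩
  exact (hT l hl n hn c' hc'.le (hstep n hn hprem)).trans (blockProb_mono_budget (Nat.zero_le k) _ _)

/-- `TilingBound → (∀ k, FrontClosing k) → PinholeClosing` — concludes the crux BY NAME. -/
theorem pinholeClosing_of_frontClosing (hT : TilingBound) (hF : ∀ k, FrontClosing k) :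
    PercBudgetLadder.PinholeClosing := by
  rw [pinholeClosing_iff]
  intro k
  exact level_of_frontClosing hT (hF k)

/-- `FrontClosing k` with the positivity of the premise constant DELETED. -/
def FrontClosingWithoutC (k : ℕ) : Prop :=
  ∀ (l : ℕ) (c : ℝ), 2 ≤ l → ∃ c' : ℝ, 0 < c' ∧ ∀ n : ℕ, 1 ≤ n →
    c ≤ blockProb (k + 1) n (l * n) → c' ≤ μc.real (frontCrossed n (l * n))ᶜ

/-- **The costume boundary.** Deleting the premise from `FrontClosing k` gives back exactly the card's
`∀ l ≥ 2, C⁺(l)` (cf. Disproof §2 for the crux itself): the premise is the only thing separating the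
salvage from the uniform RSW class. -/
theorem frontClosingWithoutC_iff (k : ℕ) :
    FrontClosingWithoutC k ↔ ∀ l : ℕ, 2 ≤ l → HalfSpaceAnnulusBlocking l := by
  constructor
  · intro h l hl
    obtain ⟨c', hc', hstep⟩ := h l 0 hl
    exact ⟨c', hc', fun n hn => hstep n hn (blockProb_nonneg _ _ _)⟩
  · intro h l c hl
    obtain ⟨ε, hε, hb⟩ := h l hl
    exact ⟨ε, hε, fun n hn _ => hb n hn⟩

/-- The card's line is `FrontClosing` with the premise thrown away: C⁺ ⇒ `FrontClosing k` for all `k`. -/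
theorem frontClosing_of_halfSpace (hC : ∀ l : ℕ, 2 ≤ l → HalfSpaceAnnulusBlocking l) (k : ℕ) :
    FrontClosing k := by
  intro l c hl _
  obtain ⟨ε, hε, hb⟩ := hC l hl
  exact ⟨ε, hε, fun n hn _ => hb n hn⟩

/-- Resistance (a): X_B ⇒ `FrontClosing k` — the salvage is weaker than the standing RSW crux, as r3 is
(Disproof §3 `pinholeClosing_of_critAnnulusNonCrossing`). -/
theorem frontClosing_of_critAnnulusNonCrossing (hX : PercAnnulusCrossing.CritAnnulusNonCrossing)
    (k : ℕ) : FrontClosing k :=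
  frontClosing_of_halfSpace (fun _ hl => halfSpaceAnnulusBlocking_of_critAnnulusNonCrossing hX hl) k

/-- Resistance (b): ¬r2 ⇒ `FrontClosing k` — if critical budgets are not tight the premise fails
eventually and `c'` is a finite minimum of positive numbers (as Disproof §3 for r3).  With (a): a
refutation of `FrontClosing k` would prove `BudgetTightness` and refute X_B — no cheap kill. -/
theorem frontClosing_of_not_budgetTightness (hBT : ¬ PercBudgetLadder.BudgetTightness) (k : ℕ) :
    FrontClosing k := by
  rw [budgetTightness_iff] at hBT
  push Not at hBT
  intro l c hl hc
  obtain ⟨N, hN⟩ := hBT (k + 1) l c hl hc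
  obtain ⟨c', hc', hmin⟩ := exists_pos_lower_bound (fun n => blockProb 0 n (l * n))
    (fun n hn => blockProb_pos (by nlinarith)) N
  refine ⟨c', hc', fun n hn hprem => ?_⟩
  have hnN : n < N := by
    by_contra hnN
    exact absurd hprem (not_le.2 (hN n (not_lt.1 hnN)))
  have h1 : c' ≤ blockProb 0 n (l * n) := hmin n hn hnN
  exact h1.trans (blockProb_le_frontBlocked n (l * n))

/-- Resistance certificate for the salvage, packaged: `¬ FrontClosing k → r2 ∧ ¬ X_B`. -/
theorem not_frontClosing_imp {k : ℕ} (h : ¬ FrontClosing k) :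
    PercBudgetLadder.BudgetTightness ∧ ¬ PercAnnulusCrossing.CritAnnulusNonCrossing :=
  ⟨Classical.byContradiction fun hBT => h (frontClosing_of_not_budgetTightness hBT k),
    fun hX => h (frontClosing_of_critAnnulusNonCrossing hX k)⟩

end

end Summit.CriticalPhenomena.PercolationContinuityZ3.Cruxes.PinholeClosing.FrontBlockingSuffices
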